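import Mathlib
import Literature.Analysis.FluidPDE.SuitableWeak
import Literature.Analysis.FluidPDE.SuitableWeakSliced
import Literature.Analysis.FluidPDE.SuitableWeakPressure
import Literature.Analysis.FluidPDE.ClassicalSolutionCalculus
import Literature.Analysis.FluidPDE.HeatDuhamelBack
import Literature.Analysis.FluidPDE.WeakSolutionLift
import Literature.Analysis.FluidPDE.LocalEnergySliceLEI
import Literature.Analysis.FluidPDE.WeakGradientTransportIdentity
import Literature.Analysis.FluidPDE.Seregin2023.TypeIIEulerZoomScenario
import Summits.NavierStokesRegularity.NavierStokesRegularity.Theorems.EulerZoomLiouvilleSereginZoomReductionClassBounds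
import HarnessLib

/-!
# From Seregin's sliced local energy inequality (3.7) to the CKN class on the slab
# (route №10 `EulerZoomLiouville`, support item Z = stmt-NavierStokesRegularity-19834, piece (e), part 2)

Helper file (theorems only; `--supports stmt-NavierStokesRegularity-19834`). Seat ns-typeII-p3
(cell ns-regularity-ideate §B, D-0081; DIRECTOR-NS g6 #3: the Summits-side half of Z).

The named fact `Seregin2023.seregin2026_typeII_scenario_eulerLimit` (Seregin, arXiv:2606.29468, Thm 3.1)
delivers its ancient Euler flow `(u, p)` on `Q₋ = ℝ³ × ]−∞,0[` as: a distributional Euler solution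
on the slab, a weak spatial gradient `Gu`, the weighted bound (3.5) for all `a > 0`, and the local
energy inequality in Seregin's SLICED form (3.7) — for every non-negative test function `φ` on
space–time and a.e. `τ₀ < 0`, `∫ |u(τ₀)|² φ(τ₀) ≤ ∫∫_{τ<τ₀} (|u|² ∂_τφ + (|u|² + 2p) u·∇φ)`.  The route
decl `EulerZoomLiouville.SereginZoomReduction` asks for the Caffarelli–Kohn–Nirenberg class
`IsSuitableWeakSolutionOn (slab) 0 0 u p`, whose local energy inequality is the INTEGRATED form
`0 ≤ ∫_t ∫_x (|u|² ∂_τφ + (|u|² + 2p) u·∇φ)` for non-negative tests supported in the slab (iterated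
integrals).  This file does the conversion (`isSuitableWeakSolutionOn_of_eulerLimit`):
* take a good time `τ₀` between the top of the support of `φ` and `0` (the tree's
  `IsSpaceTimeTestOn.exists_lt_forall_slice_eq_zero`, `exists_mem_Ioo_of_ae`): the left side of (3.7)
  vanishes and the right side is the integral over ALL of space–time (`localEnergy_nonneg_of_sliced`);
* the integrand `localEnergyRHS 0 0 u p φ` is INTEGRABLE on `ℝ × ℝ³` (`integrable_localEnergyRHS`):
  it is supported in the compact support of `φ`, which lies in a parabolic cylinder `Q_a(0)`, where
  `|u|² , |u|³ ∈ L¹` (the prequel's `lintegral_cylinder_cube_lt_top`, from `u ∈ L^{10/3}`) and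
  `|p|^{3/2} ∈ L¹`, and `|p||u| ≤ |p|^{3/2} + |u|³` (`mul_le_rpow_threeHalves_add_pow_three`);
* so Fubini (`integral_prod`) identifies Seregin's space–time Bochner integral with CKN's iterated one.
WHAT THIS IS NOT: not NS regularity and not Seregin's compactness theorem — bookkeeping for a
reduction modulo the typed printed fact. [folklore]
-/

noncomputable section

-- the summit and its single problem share the name `NavierStokesRegularity` (D-0017 nested layout)
set_option linter.dupNamespace false

open Set Function Filter Topology MeasureTheory Metric TopologicalSpace
open scoped NNReal ENNReal InnerProductSpace RealInnerProductSpace Laplacian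

namespace Summit.NavierStokesRegularity.NavierStokesRegularity.Theorems.SereginZoomReduction

open Literature.Analysis Literature.Analysis.FluidPDE Literature.Analysis.FluidPDE.Seregin2023

/-! ## An elementary Young-type inequality -/

/-- `a b ≤ a^{3/2} + b³` for `a, b ≥ 0` (if `a ≤ b²` then `ab ≤ b³`, else `b ≤ √a` and
`ab ≤ a√a = a^{3/2}`). [folklore] -/
theorem mul_le_rpow_threeHalves_add_pow_three {a b : ℝ} (ha : 0 ≤ a) (hb : 0 ≤ b) :
    a * b ≤ a ^ (3 / 2 : ℝ) + b ^ 3 := by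
  have h32 : a ^ (3 / 2 : ℝ) = a * Real.sqrt a := by
    rw [show (3 / 2 : ℝ) = 1 + 1 / 2 by norm_num, Real.rpow_add' ha (by norm_num), Real.rpow_one,
      Real.sqrt_eq_rpow]
  have hpos : 0 ≤ a ^ (3 / 2 : ℝ) := Real.rpow_nonneg ha _
  rcases le_or_gt a (b ^ 2) with h | h
  · have h1 : a * b ≤ b ^ 2 * b := mul_le_mul_of_nonneg_right h hb
    nlinarith
  · have hb' : b ≤ Real.sqrt a := Real.le_sqrt_of_sq_le h.le
    have h1 : a * b ≤ a * Real.sqrt a := mul_le_mul_of_nonneg_left hb' ha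
    rw [h32]
    nlinarith [pow_nonneg hb 3]

/-! ## Integrability of the local energy integrand -/

section Integrability

variable {ρ : ℝ} {c : ℝ≥0}
  {u : ℝ → EuclideanSpace ℝ (Fin 3) → EuclideanSpace ℝ (Fin 3)} {p : ℝ → EuclideanSpace ℝ (Fin 3) → ℝ}
  {Gu : ℝ → EuclideanSpace ℝ (Fin 3) → EuclideanSpace ℝ (Fin 3) →L[ℝ] EuclideanSpace ℝ (Fin 3)}

/-- **`|u|²` is integrable on compact subsets of the slab** (a clause of the distributional
notion). [folklore] -/
theorem integrableOn_normSq_of_isCompact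
    (hEu : IsDistributionalEulerSolutionOn (slab (EuclideanSpace ℝ (Fin 3)) (Iio 0) isOpen_Iio) 0 u p)
    {S : Set (ℝ × EuclideanSpace ℝ (Fin 3))} (hS : IsCompact S)
    (hSs : S ⊆ Iio (0 : ℝ) ×ˢ (univ : Set (EuclideanSpace ℝ (Fin 3)))) :
    IntegrableOn (fun z : ℝ × EuclideanSpace ℝ (Fin 3) => ‖u z.1 z.2‖ ^ 2) S volume := by
  have h := hEu.2.1
  rw [coe_slab] at h
  exact h.integrableOn_compact_subset hSs hS

/-- **`|u|³` is integrable on compact subsets of the slab** under the weighted bounds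
`A_F(u,a), E_F(Gu,a) ≤ c` (all `a > 0`), via the prequel's `u ∈ L^{10/3}(Q_a)`. [folklore] -/
theorem integrableOn_normCube_of_isCompact
    (hGu : HasWeakSpatialGradientOn (slab (EuclideanSpace ℝ (Fin 3)) (Iio 0) isOpen_Iio) u Gu)
    (hA : ∀ a : ℝ, 0 < a → weightedA (fun r => r ^ ρ) a (0 : ℝ × EuclideanSpace ℝ (Fin 3)) u ≤ (c : ℝ≥0∞))
    (hE : ∀ a : ℝ, 0 < a → weightedE (fun r => r ^ ρ) a (0 : ℝ × EuclideanSpace ℝ (Fin 3)) Gu ≤ (c : ℝ≥0∞))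
    {S : Set (ℝ × EuclideanSpace ℝ (Fin 3))} (hS : IsCompact S)
    (hSs : S ⊆ Iio (0 : ℝ) ×ˢ (univ : Set (EuclideanSpace ℝ (Fin 3)))) :
    IntegrableOn (fun z : ℝ × EuclideanSpace ℝ (Fin 3) => ‖u z.1 z.2‖ ^ 3) S volume := by
  obtain ⟨a, ha, hSa⟩ := exists_subset_parabolicCylinder_of_isCompact hS hSs
  have hmeas : AEStronglyMeasurable (uncurry u)
      (volume.restrict (Iio (0 : ℝ) ×ˢ (univ : Set (EuclideanSpace ℝ (Fin 3))))) := by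
    have := hGu.locallyIntegrableOn.aestronglyMeasurable
    simpa [slab] using this
  have hmeasS : AEStronglyMeasurable (fun z : ℝ × EuclideanSpace ℝ (Fin 3) => ‖u z.1 z.2‖ ^ 3)
      (volume.restrict S) :=
    ((hmeas.mono_set hSs).norm.pow 3)
  refine ⟨hmeasS, ?_⟩
  rw [hasFiniteIntegral_iff_enorm]
  have h1 : ∀ z : ℝ × EuclideanSpace ℝ (Fin 3), ‖‖u z.1 z.2‖ ^ 3‖ₑ = ‖u z.1 z.2‖ₑ ^ (3 : ℕ) := by
    intro z
    rw [Real.enorm_of_nonneg (pow_nonneg (norm_nonneg _) 3), ENNReal.ofReal_pow (norm_nonneg _),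
      ofReal_norm]
  simp_rw [h1]
  exact lt_of_le_of_lt (lintegral_mono_set hSa) (lintegral_cylinder_cube_lt_top ha hGu (hA a ha) (hE a ha))

/-- **`|p|^{3/2}` is integrable on compact subsets of the slab** under `D_F(p,a) ≤ c` (all `a > 0`).
[folklore] -/
theorem integrableOn_pressure_rpow_of_isCompact
    (hEu : IsDistributionalEulerSolutionOn (slab (EuclideanSpace ℝ (Fin 3)) (Iio 0) isOpen_Iio) 0 u p)
    (hD : ∀ a : ℝ, 0 < a → weightedD (fun r => r ^ ρ) a (0 : ℝ × EuclideanSpace ℝ (Fin 3)) p ≤ (c : ℝ≥0∞))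
    {S : Set (ℝ × EuclideanSpace ℝ (Fin 3))} (hS : IsCompact S)
    (hSs : S ⊆ Iio (0 : ℝ) ×ˢ (univ : Set (EuclideanSpace ℝ (Fin 3)))) :
    IntegrableOn (fun z : ℝ × EuclideanSpace ℝ (Fin 3) => |p z.1 z.2| ^ (3 / 2 : ℝ)) S volume := by
  obtain ⟨a, ha, hSa⟩ := exists_subset_parabolicCylinder_of_isCompact hS hSs
  have hmeas : AEStronglyMeasurable (uncurry p)
      (volume.restrict (Iio (0 : ℝ) ×ˢ (univ : Set (EuclideanSpace ℝ (Fin 3))))) := by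
    have := hEu.2.2.1.aestronglyMeasurable
    simpa [slab] using this
  have hmeasS : AEStronglyMeasurable (fun z : ℝ × EuclideanSpace ℝ (Fin 3) => |p z.1 z.2| ^ (3 / 2 : ℝ))
      (volume.restrict S) := by
    have h1 : AEStronglyMeasurable (fun z : ℝ × EuclideanSpace ℝ (Fin 3) => |p z.1 z.2|) (volume.restrict S) :=
      (hmeas.mono_set hSs).norm
    exact (Real.continuous_rpow_const (by norm_num)).comp_aestronglyMeasurable h1
  refine ⟨hmeasS, ?_⟩
  rw [hasFiniteIntegral_iff_enorm]
  have h1 : ∀ z : ℝ × EuclideanSpace ℝ (Fin 3), ‖|p z.1 z.2| ^ (3 / 2 : ℝ)‖ₑ = ‖p z.1 z.2‖ₑ ^ (3 / 2 : ℝ) := by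
    intro z
    rw [Real.enorm_of_nonneg (Real.rpow_nonneg (abs_nonneg _) _),
      ← ENNReal.ofReal_rpow_of_nonneg (abs_nonneg _) (by norm_num : (0 : ℝ) ≤ 3 / 2),
      ← Real.enorm_eq_ofReal_abs]
  simp_rw [h1]
  exact lt_of_le_of_lt (lintegral_mono_set hSa) (lintegral_cylinder_pressure_lt_top_of_weightedD ha (hD a ha))

/-- **The local energy integrand of Seregin's Euler limit is integrable on space–time** for every
test function `φ` supported in the slab: it is supported in the compact support `S` of `φ`, and
there `|R[φ]| ≤ C (|u|² + |u|³ + |p|^{3/2})`. [folklore] -/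
theorem integrable_localEnergyRHS
    (hEu : IsDistributionalEulerSolutionOn (slab (EuclideanSpace ℝ (Fin 3)) (Iio 0) isOpen_Iio) 0 u p)
    (hGu : HasWeakSpatialGradientOn (slab (EuclideanSpace ℝ (Fin 3)) (Iio 0) isOpen_Iio) u Gu)
    (hA : ∀ a : ℝ, 0 < a → weightedA (fun r => r ^ ρ) a (0 : ℝ × EuclideanSpace ℝ (Fin 3)) u ≤ (c : ℝ≥0∞))
    (hD : ∀ a : ℝ, 0 < a → weightedD (fun r => r ^ ρ) a (0 : ℝ × EuclideanSpace ℝ (Fin 3)) p ≤ (c : ℝ≥0∞))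
    (hE : ∀ a : ℝ, 0 < a → weightedE (fun r => r ^ ρ) a (0 : ℝ × EuclideanSpace ℝ (Fin 3)) Gu ≤ (c : ℝ≥0∞))
    {φ : ℝ → EuclideanSpace ℝ (Fin 3) → ℝ}
    (hφ : IsSpaceTimeTestOn (slab (EuclideanSpace ℝ (Fin 3)) (Iio 0) isOpen_Iio) φ) :
    Integrable (localEnergyRHS 0 0 u p φ) (volume : Measure (ℝ × EuclideanSpace ℝ (Fin 3))) := by
  set S : Set (ℝ × EuclideanSpace ℝ (Fin 3)) := tsupport (uncurry φ) with hSdef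
  have hS : IsCompact S := hφ.hasCompactSupport
  have hSs : S ⊆ Iio (0 : ℝ) ×ˢ (univ : Set (EuclideanSpace ℝ (Fin 3))) := by
    have := hφ.tsupport_subset
    rwa [coe_slab] at this
  -- the coefficient fields of the integrand
  obtain ⟨hgc, -, hg0⟩ := hφ.continuous_gradient_field
  have htc : Continuous (fun z : ℝ × EuclideanSpace ℝ (Fin 3) => timeDeriv φ z.1 z.2) := hφ.continuous_timeDeriv
  obtain ⟨Cφ, Cg, -, hCg0, -, hCg, -⟩ := hφ.exists_bound_self_and_gradient
  -- the integrand vanishes off `S`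
  have hsupp : support (localEnergyRHS 0 0 u p φ) ⊆ S := by
    intro z hz
    by_contra hzS
    apply hz
    have h1 : timeDeriv φ z.1 z.2 = 0 := IsSpaceTimeTestOn.timeDeriv_eq_zero_of_notMem hzS
    have h2 : gradient (φ z.1) z.2 = 0 := hg0 z hzS
    have h3 : φ z.1 z.2 = 0 := image_eq_zero_of_notMem_tsupport (f := uncurry φ) hzS
    rw [localEnergyRHS_apply, h1, h2, h3]
    simp
  rw [← integrableOn_iff_integrable_of_support_subset hsupp]
  -- measurability of `u`, `p` on `S`
  have hmu : AEStronglyMeasurable (fun z : ℝ × EuclideanSpace ℝ (Fin 3) => u z.1 z.2) (volume.restrict S) := by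
    have := hGu.locallyIntegrableOn.aestronglyMeasurable
    rw [coe_slab] at this
    exact this.mono_set hSs
  have hmp : AEStronglyMeasurable (fun z : ℝ × EuclideanSpace ℝ (Fin 3) => p z.1 z.2) (volume.restrict S) := by
    have := hEu.2.2.1.aestronglyMeasurable
    rw [coe_slab] at this
    exact this.mono_set hSs
  -- the three pieces
  have hI2 := integrableOn_normSq_of_isCompact hEu hS hSs
  have hI3 := integrableOn_normCube_of_isCompact hGu hA hE hS hSs
  have hIp := integrableOn_pressure_rpow_of_isCompact hEu hD hS hSs
  -- piece 1: `|u|² ∂_t φ`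
  have hP1 : IntegrableOn (fun z : ℝ × EuclideanSpace ℝ (Fin 3) => ‖u z.1 z.2‖ ^ 2 * timeDeriv φ z.1 z.2) S volume :=
    hI2.mul_continuousOn htc.continuousOn hS
  -- piece 2: `|u|² ⟪u, ∇φ⟫`, dominated by `Cg |u|³`
  have hP2 : IntegrableOn (fun z : ℝ × EuclideanSpace ℝ (Fin 3) =>
      ‖u z.1 z.2‖ ^ 2 * ⟪u z.1 z.2, gradient (φ z.1) z.2⟫) S volume := by
    refine Integrable.mono' (hI3.const_mul Cg) ?_ ?_
    · exact (hmu.norm.pow 2).mul (hmu.inner hgc.aestronglyMeasurable)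
    · refine Eventually.of_forall fun z => ?_
      rw [Real.norm_eq_abs, abs_mul, abs_pow, abs_norm]
      have h1 : |⟪u z.1 z.2, gradient (φ z.1) z.2⟫| ≤ ‖u z.1 z.2‖ * Cg :=
        (abs_real_inner_le_norm _ _).trans (mul_le_mul_of_nonneg_left (hCg _ _) (norm_nonneg _))
      calc ‖u z.1 z.2‖ ^ 2 * |⟪u z.1 z.2, gradient (φ z.1) z.2⟫|
          ≤ ‖u z.1 z.2‖ ^ 2 * (‖u z.1 z.2‖ * Cg) := mul_le_mul_of_nonneg_left h1 (sq_nonneg _)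
        _ = Cg * ‖u z.1 z.2‖ ^ 3 := by ring
  -- piece 3: `2 p ⟪u, ∇φ⟫`, dominated by `2 Cg (|p|^{3/2} + |u|³)`
  have hP3 : IntegrableOn (fun z : ℝ × EuclideanSpace ℝ (Fin 3) =>
      2 * p z.1 z.2 * ⟪u z.1 z.2, gradient (φ z.1) z.2⟫) S volume := by
    refine Integrable.mono' ((hIp.add hI3).const_mul (2 * Cg)) ?_ ?_
    · exact ((hmp.const_mul 2)).mul (hmu.inner hgc.aestronglyMeasurable)
    · refine Eventually.of_forall fun z => ?_
      rw [Real.norm_eq_abs, abs_mul, abs_mul, abs_two]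
      have h1 : |⟪u z.1 z.2, gradient (φ z.1) z.2⟫| ≤ ‖u z.1 z.2‖ * Cg :=
        (abs_real_inner_le_norm _ _).trans (mul_le_mul_of_nonneg_left (hCg _ _) (norm_nonneg _))
      have h2 : |p z.1 z.2| * ‖u z.1 z.2‖ ≤ |p z.1 z.2| ^ (3 / 2 : ℝ) + ‖u z.1 z.2‖ ^ 3 :=
        mul_le_rpow_threeHalves_add_pow_three (abs_nonneg _) (norm_nonneg _)
      calc 2 * |p z.1 z.2| * |⟪u z.1 z.2, gradient (φ z.1) z.2⟫|
          ≤ 2 * |p z.1 z.2| * (‖u z.1 z.2‖ * Cg) :=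
            mul_le_mul_of_nonneg_left h1 (by positivity)
        _ = 2 * Cg * (|p z.1 z.2| * ‖u z.1 z.2‖) := by ring
        _ ≤ 2 * Cg * (|p z.1 z.2| ^ (3 / 2 : ℝ) + ‖u z.1 z.2‖ ^ 3) :=
            mul_le_mul_of_nonneg_left h2 (by positivity)
  -- assemble
  have hsum : IntegrableOn (fun z : ℝ × EuclideanSpace ℝ (Fin 3) =>
      ‖u z.1 z.2‖ ^ 2 * timeDeriv φ z.1 z.2 +
        (‖u z.1 z.2‖ ^ 2 * ⟪u z.1 z.2, gradient (φ z.1) z.2⟫ +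
          2 * p z.1 z.2 * ⟪u z.1 z.2, gradient (φ z.1) z.2⟫)) S volume :=
    hP1.add (hP2.add hP3)
  refine hsum.congr_fun (fun z _ => ?_) hS.isClosed.measurableSet
  simp only [localEnergyRHS, zero_mul, add_zero, Pi.zero_apply, inner_zero_left, mul_zero]
  ring

end Integrability

/-! ## The integrated local energy inequality from the sliced one -/

section LEI

variable {ρ : ℝ} {c : ℝ≥0}
  {u : ℝ → EuclideanSpace ℝ (Fin 3) → EuclideanSpace ℝ (Fin 3)} {p : ℝ → EuclideanSpace ℝ (Fin 3) → ℝ}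
  {Gu : ℝ → EuclideanSpace ℝ (Fin 3) → EuclideanSpace ℝ (Fin 3) →L[ℝ] EuclideanSpace ℝ (Fin 3)}

/-- **`0 ≤ ∫∫ R[φ]` from Seregin's sliced inequality (3.7).**  For a non-negative test function `φ`
supported in the slab, pick an a.e.-good time `τ₀ < 0` above the support: (3.7) at `τ₀` reads
`0 ≤ ∫_{τ < τ₀} R[φ] = ∫ R[φ]`. [folklore] -/
theorem integral_localEnergyRHS_nonneg_of_sliced
    (hLEI : ∀ φ : ℝ → EuclideanSpace ℝ (Fin 3) → ℝ,
      IsSpaceTimeTestOn (⊤ : Opens (ℝ × EuclideanSpace ℝ (Fin 3))) φ → (∀ t x, 0 ≤ φ t x) →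
        ∀ᵐ τ₀ ∂(volume : Measure ℝ), τ₀ < 0 →
          ∫ y, ‖u τ₀ y‖ ^ 2 * φ τ₀ y ≤
            ∫ z in {z : ℝ × EuclideanSpace ℝ (Fin 3) | z.1 < τ₀}, localEnergyRHS 0 0 u p φ z)
    {φ : ℝ → EuclideanSpace ℝ (Fin 3) → ℝ}
    (hφ : IsSpaceTimeTestOn (slab (EuclideanSpace ℝ (Fin 3)) (Iio 0) isOpen_Iio) φ) (hpos : ∀ t x, 0 ≤ φ t x) :
    0 ≤ ∫ z, localEnergyRHS 0 0 u p φ z := by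
  obtain ⟨T', hT'0, hT'⟩ := hφ.exists_lt_forall_slice_eq_zero
  have hae := hLEI φ (hφ.mono le_top) hpos
  obtain ⟨τ₀, hτ₀, hgood⟩ := exists_mem_Ioo_of_ae hae hT'0
  have hineq := hgood hτ₀.2
  -- the left side vanishes: `φ τ₀ = 0`
  have hL : ∫ y, ‖u τ₀ y‖ ^ 2 * φ τ₀ y = 0 := by
    simp [hT' τ₀ hτ₀.1.le]
  -- the right side is the full integral: the integrand vanishes for `τ ≥ τ₀ > T'`
  obtain ⟨-, -, hg0⟩ := hφ.continuous_gradient_field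
  have hnot : ∀ z : ℝ × EuclideanSpace ℝ (Fin 3), T' < z.1 → z ∉ tsupport (uncurry φ) := by
    intro z hz hzS
    have h0 : uncurry φ =ᶠ[𝓝 z] 0 := by
      have hopen : IsOpen {w : ℝ × EuclideanSpace ℝ (Fin 3) | T' < w.1} := isOpen_lt continuous_const continuous_fst
      filter_upwards [hopen.mem_nhds hz] with w hw
      show φ w.1 w.2 = 0
      rw [hT' w.1 (le_of_lt hw)]
      rfl
    exact (notMem_tsupport_iff_eventuallyEq.2 h0) hzS
  have hR : ∫ z in {z : ℝ × EuclideanSpace ℝ (Fin 3) | z.1 < τ₀}, localEnergyRHS 0 0 u p φ z =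
      ∫ z, localEnergyRHS 0 0 u p φ z := by
    refine setIntegral_eq_integral_of_forall_compl_eq_zero fun z hz => ?_
    have hz' : τ₀ ≤ z.1 := not_lt.1 hz
    have hzS : z ∉ tsupport (uncurry φ) := hnot z (lt_of_lt_of_le hτ₀.1 hz')
    have h1 : timeDeriv φ z.1 z.2 = 0 := IsSpaceTimeTestOn.timeDeriv_eq_zero_of_notMem hzS
    have h2 : gradient (φ z.1) z.2 = 0 := hg0 z hzS
    have h3 : φ z.1 z.2 = 0 := image_eq_zero_of_notMem_tsupport (f := uncurry φ) hzS
    rw [localEnergyRHS_apply, h1, h2, h3]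
    simp
  rw [hL, hR] at hineq
  exact hineq

/-- **The CKN local energy inequality of Seregin's Euler limit** (`ν = 0`, `f = 0`), in the literal
shape of `IsSuitableWeakSolutionOn.localEnergy`: the iterated integral `∫_t ∫_x R[φ]` is the
space–time integral (Fubini, the integrand being integrable) and the latter is `≥ 0` by (3.7).
[folklore] -/
theorem localEnergy_of_sliced
    (hEu : IsDistributionalEulerSolutionOn (slab (EuclideanSpace ℝ (Fin 3)) (Iio 0) isOpen_Iio) 0 u p)
    (hGu : HasWeakSpatialGradientOn (slab (EuclideanSpace ℝ (Fin 3)) (Iio 0) isOpen_Iio) u Gu)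
    (hA : ∀ a : ℝ, 0 < a → weightedA (fun r => r ^ ρ) a (0 : ℝ × EuclideanSpace ℝ (Fin 3)) u ≤ (c : ℝ≥0∞))
    (hD : ∀ a : ℝ, 0 < a → weightedD (fun r => r ^ ρ) a (0 : ℝ × EuclideanSpace ℝ (Fin 3)) p ≤ (c : ℝ≥0∞))
    (hE : ∀ a : ℝ, 0 < a → weightedE (fun r => r ^ ρ) a (0 : ℝ × EuclideanSpace ℝ (Fin 3)) Gu ≤ (c : ℝ≥0∞))
    (hLEI : ∀ φ : ℝ → EuclideanSpace ℝ (Fin 3) → ℝ,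
      IsSpaceTimeTestOn (⊤ : Opens (ℝ × EuclideanSpace ℝ (Fin 3))) φ → (∀ t x, 0 ≤ φ t x) →
        ∀ᵐ τ₀ ∂(volume : Measure ℝ), τ₀ < 0 →
          ∫ y, ‖u τ₀ y‖ ^ 2 * φ τ₀ y ≤
            ∫ z in {z : ℝ × EuclideanSpace ℝ (Fin 3) | z.1 < τ₀}, localEnergyRHS 0 0 u p φ z) :
    ∀ φ : ℝ → EuclideanSpace ℝ (Fin 3) → ℝ,
      IsSpaceTimeTestOn (slab (EuclideanSpace ℝ (Fin 3)) (Iio 0) isOpen_Iio) φ → (∀ t x, 0 ≤ φ t x) →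
        2 * (0 : ℝ) * ∫ t, ∫ x, frobeniusNormSq (Gu t x) * φ t x ≤
          ∫ t, ∫ x, (‖u t x‖ ^ 2 * (timeDeriv φ t x + 0 * Δ (φ t) x) +
            (‖u t x‖ ^ 2 + 2 * p t x) * ⟪u t x, gradient (φ t) x⟫ +
            2 * ⟪(0 : ℝ → EuclideanSpace ℝ (Fin 3) → EuclideanSpace ℝ (Fin 3)) t x, u t x⟫ * φ t x) := by
  intro φ hφ hpos
  rw [mul_zero, zero_mul]
  have hint := integrable_localEnergyRHS hEu hGu hA hD hE hφ
  have hnn := integral_localEnergyRHS_nonneg_of_sliced hLEI hφ hpos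
  have hfub : ∫ z, localEnergyRHS 0 0 u p φ z = ∫ t, ∫ x, localEnergyRHS 0 0 u p φ (t, x) := by
    rw [Measure.volume_eq_prod] at hint ⊢
    exact integral_prod _ hint
  rw [hfub] at hnn
  exact hnn

/-- **Seregin's Euler limit is a CKN suitable weak solution on the slab** (`ν = 0`, `f = 0`):
distributional Euler solution + weak gradient + the weighted bound (3.5) + the sliced local energy
inequality (3.7) ⇒ `IsSuitableWeakSolutionOn (slab ℝ³ ]−∞,0[) 0 0 u p`. [folklore] -/
theorem isSuitableWeakSolutionOn_of_eulerLimit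
    (hEu : IsDistributionalEulerSolutionOn (slab (EuclideanSpace ℝ (Fin 3)) (Iio 0) isOpen_Iio) 0 u p)
    (hGu : HasWeakSpatialGradientOn (slab (EuclideanSpace ℝ (Fin 3)) (Iio 0) isOpen_Iio) u Gu)
    (hA : ∀ a : ℝ, 0 < a → weightedA (fun r => r ^ ρ) a (0 : ℝ × EuclideanSpace ℝ (Fin 3)) u ≤ (c : ℝ≥0∞))
    (hD : ∀ a : ℝ, 0 < a → weightedD (fun r => r ^ ρ) a (0 : ℝ × EuclideanSpace ℝ (Fin 3)) p ≤ (c : ℝ≥0∞))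
    (hE : ∀ a : ℝ, 0 < a → weightedE (fun r => r ^ ρ) a (0 : ℝ × EuclideanSpace ℝ (Fin 3)) Gu ≤ (c : ℝ≥0∞))
    (hLEI : ∀ φ : ℝ → EuclideanSpace ℝ (Fin 3) → ℝ,
      IsSpaceTimeTestOn (⊤ : Opens (ℝ × EuclideanSpace ℝ (Fin 3))) φ → (∀ t x, 0 ≤ φ t x) →
        ∀ᵐ τ₀ ∂(volume : Measure ℝ), τ₀ < 0 →
          ∫ y, ‖u τ₀ y‖ ^ 2 * φ τ₀ y ≤
            ∫ z in {z : ℝ × EuclideanSpace ℝ (Fin 3) | z.1 < τ₀}, localEnergyRHS 0 0 u p φ z) :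
    IsSuitableWeakSolutionOn (slab (EuclideanSpace ℝ (Fin 3)) (Iio 0) isOpen_Iio) 0 0 u p where
  distributional := hEu
  energyClass := energyClass_of_weightedA hA
  pressure := pressureClass_of_weightedD hD
  localEnergy := ⟨Gu, hGu, gradClass_of_weightedE hE, localEnergy_of_sliced hEu hGu hA hD hE hLEI⟩

end LEI

end Summit.NavierStokesRegularity.NavierStokesRegularity.Theorems.SereginZoomReduction

end
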